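import Summits.AtomisticToContinuum.FouriersLaw.Theses.StaticAbelianSqueeze
import Summits.AtomisticToContinuum.FouriersLaw.Theorems.EmbeddedDrudeMourreAbelThermodynamicLimitOfLowerBound
import Summits.AtomisticToContinuum.FouriersLaw.Theorems.EmbeddedDrudeMourreAbelThermodynamicLimitWitnessPositiveType
import HarnessLib

/-!
# Glue of composition A, line `Sketch`: contact splice ∧ bulk Abel convergence ⟹ the Abel-summable splice
(crux `StaticAbelianSqueeze.UniformAbelianRegularity` = (R), item stmt-AtomisticToContinuum-13416; `--supports` file proving the
registered glue stub `stub_abelSummableSpliceOfContactSpliceOfBulkAbel`; closes nothing)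

The registered stub asks for `∃ C E M Λ c₀ K N₁` with seven bulk/contact clauses and the linear-horizon `L¹` splice
`∫_{(0,c₀N]} |c_N − (N−1)C − E| ≤ K` (`N ≥ N₁`).  With the bulk function PINNED to the unconditional regular pair
`(μT, D)` of `exists_regularPair` (transfer-operator DLR state + Buttà–Marchioro flow on `bmGood`), the landed
`stub_witnessPositiveType` (p91227) discharges `Measurable C`, `|C| ≤ M` and positive type for
`C := D.currentCorrelation μT`.  What remains is EXACTLY the two hypotheses below (the registered physical stubs `stub_contactSplice`,
`stub_bulkAbelRegularPair` of the skeleton, rev 5), neither of which is a landed theorem or follows from one: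

* (M1) `hSplice` — LINEAR-HORIZON CONTACT SPLICE w.r.t. the regular pair (K3 ∧ K2 of the line): an `N`-free
  measurable, locally integrable, Cesàro-small `E` and `c₀ > 0`, `K`, `N₁` with the `L¹((0,c₀N])` splice bound.
  Nearest landed facts: `stub_fixedTimeMatchingOfUniformLeaves` / `stub_fixedFrequencyMatching` (p127009):
  `c_N(t)/N → C(t)` at FIXED `t` (qualitative, rate-free, per-length); `stub_uniformAnchoredCorrelationTails` (p119825) /
  `pinnedChain_singleFlipLocality`: the `N`-uniform open-chain light cone at FIXED horizon `τ` with onset distance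
  `D₀(τ) = ⌈c²⌉₊+1`, `c = 12e·A·max(τ,1)` (so `D₀ ≍ τ²`) and polynomial tails `b(τ)/D²`, `b(τ) ≳ τ⁴` — unusable at `τ ≍ N`; no semi-infinite (one-bath) chain object
  and no item defining/limiting the contact correction `E` (nearest: `BoundaryEscapeDeficit.HalfChainLocality`, stmt-12240,
  fixed-`t` limit of the bath-site kinetic autocorrelation, open).  A linear light cone is open even pathwise for the
  infinite quartic-coupling flow (Buttà–Marchioro 2016, remark after Thm 2.2, vendored in `InfiniteChainLightCone`).
* (M2) `hAbel` — ABEL MEANS OF THE REGULAR PAIR'S CORRELATION CONVERGE.  Landed only as a CONSEQUENCE of (R) itself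
  (`exists_regularPair_commonLimit_of_regularity`, `stub_regularityIffCommonLimit` p132484) or of the six HoelderEscapeProfile
  engine cruxes (`regularAbelWitness_of_engine`, p157859); item-level suppliers: `LatticeLandauDamping.AbelGreenKubo`
  (stmt-14010, open target) together with the witness seam `stub_witnessShiftInvariant` (SI, stmt-12596/14013, open) to move
  its witness onto the regular pair (landed `exists_regularDynamics_sameKappa` + `InfiniteChainTightRegular`).
-/

noncomputable section

namespace Summit.AtomisticToContinuum.FouriersLaw.Theorems.UniformAbelianRegularity.ZeroMeanDyadicSplice

open MeasureTheory Set Filter Topology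
open Literature.MathematicalPhysics.KineticTheory.HeatConduction
open Summit.AtomisticToContinuum.FouriersLaw.Theorems.AbelThermodynamicLimit.LoomisCompactHorizonWitness
  (exists_regularPair stub_witnessPositiveType)

/-- **Registered glue stub `stub_abelSummableSpliceOfContactSpliceOfBulkAbel` of line `Sketch` (crux stmt-AtomisticToContinuum-13416).**
(M1) the linear-horizon contact splice w.r.t. every regular pair and (M2) convergence of the Abel means of every regular pair's current
correlation imply the registered stub `stub_abelSummableSplice` VERBATIM, with `C := D.currentCorrelation μT` for the regular pair of
`exists_regularPair`; measurability, boundedness and positive type of `C` are the landed `stub_witnessPositiveType` (p91227).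
Written by a wave-3 stub-worker of the lead (c1). [folklore] -/
theorem stub_abelSummableSpliceOfContactSpliceOfBulkAbel :
    (∀ ω₂ lam β γ : ℝ, 0 < ω₂ → 0 < lam → 0 < β → 0 < γ → ∀ T : ℝ, 0 < T → ∀ (μT : MeasureTheory.Measure Literature.MathematicalPhysics.KineticTheory.HeatConduction.ChainConfig) (D : Literature.MathematicalPhysics.KineticTheory.HeatConduction.InfiniteChainDynamics (Literature.MathematicalPhysics.KineticTheory.HeatConduction.pinnedChain ω₂ lam β γ)), (Literature.MathematicalPhysics.KineticTheory.HeatConduction.pinnedChain ω₂ lam β γ).IsChainGibbsMeasure T μT → Literature.MathematicalPhysics.KineticTheory.HeatConduction.IsShiftInvariant μT → (Literature.MathematicalPhysics.KineticTheory.HeatConduction.pinnedChain ω₂ lam β γ).HasSuperstabilityEstimate μT → D.carrier ⊆ (Literature.MathematicalPhysics.KineticTheory.HeatConduction.pinnedChain ω₂ lam β γ).bmGood → D.PreservesMeasure μT → (∀ t : ℝ, D.HasAbsConvergentCorrelation μT t) → ∃ (E : ℝ → ℝ) (c₀ K : ℝ) (N₁ : ℕ), 0 < c₀ ∧ 0 ≤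 K ∧ Measurable E ∧ (∀ τ : ℝ, 0 < τ → MeasureTheory.IntegrableOn E (Set.Ioc 0 τ)) ∧ (∀ ε : ℝ, 0 < ε → ∃ τ₀ : ℝ, 0 < τ₀ ∧ ∀ τ : ℝ, τ₀ ≤ τ → ∫ t in Set.Ioc 0 τ, |E t| ≤ ε * τ) ∧ (∀ N : ℕ, N₁ ≤ N → let J : Literature.MathematicalPhysics.KineticTheory.HeatConduction.PhaseSpace N → ℝ := fun z => ∑ i : Fin N, (Literature.MathematicalPhysics.KineticTheory.HeatConduction.pinnedChain ω₂ lam β γ).bondCurrent N i z; ∫ t in Set.Ioc 0 (c₀ * N), |(∫ z, J z * (∫ y, J y ∂((Literature.MathematicalPhysics.KineticTheory.HeatConduction.pinnedChain ω₂ lam β γ).transitionKernel N T T t.toNNReal z)) ∂((Literature.MathematicalPhysics.KineticTheory.HeatConduction.pinnedChain ω₂ lam β γ).gibbsMeasure N T)) - ((N:ℝ) - 1) * D.currentCorrelation μT t - E t| ≤ K)) →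
    (∀ ω₂ lam β γ : ℝ, 0 < ω₂ → 0 < lam → 0 < β → 0 < γ → ∀ T : ℝ, 0 < T → ∀ (μT : MeasureTheory.Measure Literature.MathematicalPhysics.KineticTheory.HeatConduction.ChainConfig) (D : Literature.MathematicalPhysics.KineticTheory.HeatConduction.InfiniteChainDynamics (Literature.MathematicalPhysics.KineticTheory.HeatConduction.pinnedChain ω₂ lam β γ)), (Literature.MathematicalPhysics.KineticTheory.HeatConduction.pinnedChain ω₂ lam β γ).IsChainGibbsMeasure T μT → Literature.MathematicalPhysics.KineticTheory.HeatConduction.IsShiftInvariant μT → (Literature.MathematicalPhysics.KineticTheory.HeatConduction.pinnedChain ω₂ lam β γ).HasSuperstabilityEstimate μT → D.carrier ⊆ (Literature.MathematicalPhysics.KineticTheory.HeatConduction.pinnedChain ω₂ lam β γ).bmGood → D.PreservesMeasure μT → (∀ t : ℝ, D.HasAbsConvergentCorrelation μT t) → ∃ Λ : ℝ, Filter.Tendsto (fun ν : ℝ => ∫ t in Set.Ioi (0:ℝ), Real.exp (-(ν * t)) * D.currentCorrelation μT t) (nhdsWithin (0:ℝ) (Set.Ioi 0)) (nhds Λ))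 →
    ∀ ω₂ lam β γ : ℝ, 0 < ω₂ → 0 < lam → 0 < β → 0 < γ → ∀ T : ℝ, 0 < T →
      ∃ (C E : ℝ → ℝ) (M Λ c₀ K : ℝ) (N₁ : ℕ),
        0 < c₀ ∧ 0 ≤ K ∧ Measurable C ∧ Measurable E ∧ (∀ t : ℝ, |C t| ≤ M) ∧
        (∀ t : ℝ, 0 ≤ t → 0 ≤ ∫ u in Set.Ioc (0:ℝ) t, (t - u) * C u) ∧
        Filter.Tendsto (fun ν : ℝ => ∫ t in Set.Ioi (0:ℝ), Real.exp (-(ν * t)) * C t) (nhdsWithin (0:ℝ) (Set.Ioi 0)) (nhds Λ) ∧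
        (∀ τ : ℝ, 0 < τ → MeasureTheory.IntegrableOn E (Set.Ioc 0 τ)) ∧
        (∀ ε : ℝ, 0 < ε → ∃ τ₀ : ℝ, 0 < τ₀ ∧ ∀ τ : ℝ, τ₀ ≤ τ → ∫ t in Set.Ioc 0 τ, |E t| ≤ ε * τ) ∧
        (∀ N : ℕ, N₁ ≤ N → let J : Literature.MathematicalPhysics.KineticTheory.HeatConduction.PhaseSpace N → ℝ := fun z => ∑ i : Fin N, (Literature.MathematicalPhysics.KineticTheory.HeatConduction.pinnedChain ω₂ lam β γ).bondCurrent N i z; ∫ t in Set.Ioc 0 (c₀ * N), |(∫ z, J z * (∫ y, J y ∂((Literature.MathematicalPhysics.KineticTheory.HeatConduction.pinnedChain ω₂ lam β γ).transitionKernel N T T t.toNNReal z)) ∂((Literature.MathematicalPhysics.KineticTheory.HeatConduction.pinnedChain ω₂ lam β γ).gibbsMeasure N T)) - ((N:ℝ) - 1) * C t - E t| ≤ K) := by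
  intro hSplice hAbel ω₂ lam β γ hω hl hβ hγ T hT
  obtain ⟨μT, D, hG, hS, hss, hcar, hP, hAC⟩ := exists_regularPair ω₂ lam β γ hω hl hβ hγ T hT
  obtain ⟨hmeas, ⟨M, hM⟩, hpos⟩ :=
    stub_witnessPositiveType ω₂ lam β γ hω hl hβ hγ T hT μT D hG hS hss hcar hP hAC
  obtain ⟨Λ, hΛ⟩ := hAbel ω₂ lam β γ hω hl hβ hγ T hT μT D hG hS hss hcar hP hAC
  obtain ⟨E, c₀, K, N₁, hc₀, hK0, hEm, hEi, hEc, hsp⟩ :=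
    hSplice ω₂ lam β γ hω hl hβ hγ T hT μT D hG hS hss hcar hP hAC
  exact ⟨D.currentCorrelation μT, E, M, Λ, c₀, K, N₁, hc₀, hK0, hmeas, hEm, hM, hpos, hΛ, hEi, hEc,
    fun N hN => hsp N hN⟩

/-- **(R) already forces (M2) for SOME regular pair** (landed direction, recorded for the lead: the Abel clause of the
stub is (R)-necessary, so asking it loses nothing for stmt-13416, but it is not available unconditionally).
[cite: KunduDharNarayan2009, eqs. (8)–(15)] -/
theorem bulkAbel_of_regularity
    (hR : Summit.AtomisticToContinuum.FouriersLaw.Theses.StaticAbelianSqueeze.UniformAbelianRegularity) :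
    ∀ ω₂ lam β γ : ℝ, 0 < ω₂ → 0 < lam → 0 < β → 0 < γ → ∀ T : ℝ, 0 < T →
      ∃ (μT : MeasureTheory.Measure Literature.MathematicalPhysics.KineticTheory.HeatConduction.ChainConfig)
        (D : Literature.MathematicalPhysics.KineticTheory.HeatConduction.InfiniteChainDynamics
          (Literature.MathematicalPhysics.KineticTheory.HeatConduction.pinnedChain ω₂ lam β γ)) (Λ : ℝ),
        (Literature.MathematicalPhysics.KineticTheory.HeatConduction.pinnedChain ω₂ lam β γ).IsChainGibbsMeasure T μT ∧
        Literature.MathematicalPhysics.KineticTheory.HeatConduction.IsShiftInvariant μT ∧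
        (Literature.MathematicalPhysics.KineticTheory.HeatConduction.pinnedChain ω₂ lam β γ).HasSuperstabilityEstimate μT ∧
        D.carrier ⊆ (Literature.MathematicalPhysics.KineticTheory.HeatConduction.pinnedChain ω₂ lam β γ).bmGood ∧
        D.PreservesMeasure μT ∧ (∀ t : ℝ, D.HasAbsConvergentCorrelation μT t) ∧
        Filter.Tendsto (fun ν : ℝ => ∫ t in Set.Ioi (0:ℝ), Real.exp (-(ν * t)) * D.currentCorrelation μT t)
          (nhdsWithin (0:ℝ) (Set.Ioi 0)) (nhds Λ) := by
  intro ω₂ lam β γ hω hl hβ hγ T hT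
  have hU := Summit.AtomisticToContinuum.FouriersLaw.Theorems.nessUnique_proof ω₂ lam β γ hω hl hβ hγ
  obtain ⟨μT, D, L, hG, hS, hss, hcar, hP, hAC, hL, -⟩ :=
    Summit.AtomisticToContinuum.FouriersLaw.Theorems.AbelThermodynamicLimit.LoomisCompactHorizonWitness.exists_regularPair_commonLimit_of_regularity
      hR ω₂ lam β γ hω hl hβ hγ hU T hT
  exact ⟨μT, D, L, hG, hS, hss, hcar, hP, hAC, hL⟩

end Summit.AtomisticToContinuum.FouriersLaw.Theorems.UniformAbelianRegularity.ZeroMeanDyadicSplice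

end
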